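/-
Copyright (c) 2026 the pub-hodgecm-mathlib formalisation cell (harness21).  Prover seat hodgecm-mathlib-B-p14 (g33), 2026-09-01.  Road «W′» = «R1LL-WILD»
((W′-B6) sub-socket (B6-V) «value laws on the torus», owner B-p14 (g33)): THE WINDOW SIGN — the norm dichotomy of the unit part `β₁` and the `±` between the shell
averages of `t` and of its partner `e t` (Labesse–Langlands (2.2); Labesse 2024 Th. 0.0.12 `κ(c₂) = κ(det x̃)·κ(b)`).
-/
import Literature.NumberTheory.Rogawski1990.RankOneKappaShellAverageRenormalise       -- ★ p844282 (this seat): `exists_descent_conj_and_setIntegral_conj_prod_eq` (renormalise the shell average by a root-stabiliser lift)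
import Literature.NumberTheory.Rogawski1990.RankOneUnstableWildDepthSignDictionary     -- ★ p844273 (A-p03): brings ★ `exists_mul_conjLocal_eq_toLocalRing_iff`, ★ `hilbertSymbol_eq_one_iff_mem_quadraticNormSubgroup`, ★ bilinearity, `conjLocal_apply_eq_galAdicCompletionMap`
import Literature.NumberTheory.Automorphic.HeckeTransversalGL                           -- ★ `mem_glInt_of_isIntegralMatrix`
import HarnessLib

/-!
# The window sign: `fbar_m(t) − fbar_m(e t) = (β₁, θ)_v · (F̄(A) − F̄(B))` — the norm dichotomy of the unit part (road «W′», (B6-V))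

Topic `NumberTheory/Rogawski1990`; namespace `Literature.NumberTheory.Rogawski1990`.  THEOREMS ONLY (no definition, no instance, no notation, no named fact, no `sorry`); kernel
lane.  Cell `pub/hodgecm-mathlib`, crux H413 = stmt-HodgeConjecture-24833; road «W′» = «R1LL-WILD» (architect A-p16 (g28); (W′-B6) F0P3-p01 (g14); sub-socket (B6-V), owner
B-p14 (g33), census `B-provers/B-p14/g33/CENSUS-B6V-ValueLaws.B-p14g33.md` §1 «sign»).
HONEST LABEL: HC_CM is proved only modulo the cell's 2 remaining named inputs (hLiu418, h413) until rung 0 closes; this file is the `U_w`-dress of a local-class-field-theoretic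
dichotomy whose ingredients are all ★ (norm index two, Hilbert-symbol bilinearity); print cited for orientation.

THE MATHEMATICS [LabesseLanglands1979 §2 (2.2) p. 9; Labesse2024 Th. 0.0.12; Omeara1963 §63B].  At a window shell the conjugate `X` of the torus element `t` has projective
descent `ζ · ι(S)` whose lower-left entry carries a UNIT `β₁ ∈ 𝒪_v^×` (the unit part of the torus coordinate), and the conjugate `Y` of the PARTNER `e t = Ad(D_u) t` has descent
`ζ · ι(D_{u_F} S D_{u_F}⁻¹)`, `u = ι u_F` a non-norm unit.  Renormalising the shell average by the root-stabiliser lift of `D_y = diag(1, y)` is allowed exactly when `y` is a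
NORM from `L_w` (★ `exists_descent_conj_and_setIntegral_conj_prod_eq`), and moves the descent to `ζ · ι(D_y⁻¹ S D_y)`.  Since `[L⁺_v^× : N L_w^×] = 2` with `u_F ∉ N` (Hilbert symbol
`(·, θ)_v`, ★ bilinearity), EITHER `β₁ ∈ N` — then `X ↦ A := D_{β₁}⁻¹ S D_{β₁}`, `Y ↦ B := D_{β₁∕u_F}⁻¹ S D_{β₁∕u_F}` — OR `β₁ u_F^{±1} ∈ N` — then `X ↦ B`, `Y ↦ A`.  Hence
  `F̄(X) − F̄(Y) = (β₁, θ)_v · (F̄(X_A) − F̄(X_B))`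
with `X_A`, `X_B` the (unique) unitary elements of descents `ζ · ι(A)`, `ζ · ι(B)` — the `β₁`-FREE normal forms, continuous in the torus parameter (B-p04 ★ `continuousAt_windowMatrix`).
This is the `κT t · (Φ i t − ΦD i t)` shape of F0P3-p01's `hwin`.

* §1 `exists_mul_galAdicCompletionMap_eq_toPlace_of_hilbertSymbol_eq_one` (symbol `1` ⇒ norm from `L_w`, at the place), `hilbertSymbol_eq_neg_one_of_not_exists_norm`,
  **`norm_dichotomy_of_hilbertSymbol_eq_neg_one`**.
* §2 diagonal bookkeeping: `glDiagonal_one_mk0_mem_glInt`, `glDiagonal_inv_mul_conj_mul_eq_div` (`D_x⁻¹ (D_u S D_u⁻¹) D_x = D_{x∕u}⁻¹ S D_{x∕u}`), `glDiagonal_inv_mul_conj_mul_eq_of_mul`.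
* §3 **`exists_normalForms_setIntegral_sub_eq_hilbertSymbol_mul`** (the window sign at one shell, `U_w`∕`H_v` level).

## References
* [LabesseLanglands1979] J.-P. Labesse, R. P. Langlands, *L-indistinguishability for SL(2)*, Canad. J. Math. 31 (1979): §2 (2.2) p. 9.
* [Labesse2024StabilisationGermesSL2] J.-P. Labesse, *Stabilisation et germes pour SL(2)* (2024): Th. 0.0.12.
* [Omeara1963] O. T. O'Meara, *Introduction to Quadratic Forms* (1963): §63B (Hilbert symbol and norms).
-/

set_option autoImplicit false

noncomputable section

open MeasureTheory Topology Set Function NumberField IsDedekindDomain ValuativeRel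
open scoped MatrixGroups Matrix ValuativeRel

namespace Literature.NumberTheory.Rogawski1990

open Literature.NumberTheory.Automorphic Literature.NumberTheory.Automorphic.UnitaryGroup Literature.NumberTheory.GaloisRepresentations
  Literature.NumberTheory.Automorphic.HermitianLatticeTree Literature.NumberTheory.QuadraticForms

variable (L : Type) [Field L] [NumberField L] [IsCMField L] (v : HeightOneSpectrum (𝓞 ↥(maximalRealSubfield L)))
  (w : PlacesOver L v) (hw : IsCMField.complexConj L • w.1 = w.1)

/-! ## §1 Symbol `1` ⇔ norm at the place, and the dichotomy -/

/-- Bookkeeping (private): `θ ≠ 0` in `L⁺_v` (`θ` is not a square in `L⁺`). [folklore] -/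
private theorem theta_ne_zero :
    (algebraMap ↥(maximalRealSubfield L) (v.adicCompletion ↥(maximalRealSubfield L)) ((cmQuadraticGenerator L : 𝓞 ↥(maximalRealSubfield L)) : ↥(maximalRealSubfield L))) ≠ 0 := by
  rw [Ne, map_eq_zero_iff _ (algebraMap ↥(maximalRealSubfield L) (v.adicCompletion ↥(maximalRealSubfield L))).injective]
  exact fun h => not_isSquare_cmQuadraticGenerator L (by rw [h]; exact IsSquare.zero)

include hw in
/-- **Symbol `1` ⇒ norm from `L_w`** (the converse of ★ `hilbertSymbol_eq_one_of_toPlace_eq_mul_galAdicCompletionMap`): if `(n, θ)_v = 1`, `n ≠ 0`, then `ι_w n = z · σ_w z` for some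
`z ∈ L_w` (★ local norm dictionary read at the unique place over `v`). [cite: Omeara1963, §63B] -/
theorem exists_mul_galAdicCompletionMap_eq_toPlace_of_hilbertSymbol_eq_one {n : (v.adicCompletion ↥(maximalRealSubfield L))} (hn0 : n ≠ 0)
    (h : hilbertSymbol (v.adicCompletion ↥(maximalRealSubfield L)) n (algebraMap ↥(maximalRealSubfield L) (v.adicCompletion ↥(maximalRealSubfield L)) ((cmQuadraticGenerator L : 𝓞 ↥(maximalRealSubfield L)) : ↥(maximalRealSubfield L))) = 1) :
    ∃ z : (w.1.adicCompletion L), z * (galAdicCompletionMap (L := L) (IsCMField.complexConj L) hw) z = toPlace v w n := by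
  haveI : CharZero (v.adicCompletion ↥(maximalRealSubfield L)) := charZero_of_injective_algebraMap (algebraMap ↥(maximalRealSubfield L) (v.adicCompletion ↥(maximalRealSubfield L))).injective
  haveI : NeZero (2 : (v.adicCompletion ↥(maximalRealSubfield L))) := ⟨two_ne_zero⟩
  have hθ0 := theta_ne_zero L v
  classical
  have hmem := (hilbertSymbol_eq_one_iff_mem_quadraticNormSubgroup hθ0 (Units.mk0 n hn0)).1 (by rw [Units.val_mk0]; exact h)
  obtain ⟨y, hy⟩ := (exists_mul_conjLocal_eq_toLocalRing_iff (L := L) v (Units.mk0 n hn0)).2 hmem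
  refine ⟨y w, ?_⟩
  have h' := congrFun hy w
  rw [Pi.mul_apply, conjLocal_apply_eq_galAdicCompletionMap L v w hw, toLocalRing_apply, Units.val_mk0] at h'
  exact h'

include hw in
/-- **Not a norm ⇒ symbol `−1`**: if `ι_w n` is not of the form `σ_w z · z` then `(n, θ)_v = −1`. [cite: Omeara1963, §63B] -/
theorem hilbertSymbol_eq_neg_one_of_not_exists_norm {n : (v.adicCompletion ↥(maximalRealSubfield L))} (hn0 : n ≠ 0) (hun : ¬ ∃ z : (w.1.adicCompletion L), toPlace v w n = (galAdicCompletionMap (L := L) (IsCMField.complexConj L) hw) z * z) :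
    hilbertSymbol (v.adicCompletion ↥(maximalRealSubfield L)) n (algebraMap ↥(maximalRealSubfield L) (v.adicCompletion ↥(maximalRealSubfield L)) ((cmQuadraticGenerator L : 𝓞 ↥(maximalRealSubfield L)) : ↥(maximalRealSubfield L))) = -1 := by
  rcases hilbertSymbol_eq_one_or_eq_neg_one n (algebraMap ↥(maximalRealSubfield L) (v.adicCompletion ↥(maximalRealSubfield L)) ((cmQuadraticGenerator L : 𝓞 ↥(maximalRealSubfield L)) : ↥(maximalRealSubfield L))) with h | h
  · obtain ⟨z, hz⟩ := exists_mul_galAdicCompletionMap_eq_toPlace_of_hilbertSymbol_eq_one L v w hw hn0 h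
    exact absurd ⟨z, by rw [← hz, mul_comm]⟩ hun
  · exact h

include hw in
/-- **THE NORM DICHOTOMY** (norm index two, via Hilbert-symbol bilinearity): for a non-norm unit `u_F` (`(u_F, θ)_v = −1`) and `β ≠ 0`, EITHER `(β, θ)_v = 1` and `β` is a norm, OR
`(β, θ)_v = −1` and both `β∕u_F` and `β·u_F` are norms from `L_w`. [cite: Omeara1963, §63B] [cite: LabesseLanglands1979, §2 p. 9] -/
theorem norm_dichotomy_of_hilbertSymbol_eq_neg_one {uF β : (v.adicCompletion ↥(maximalRealSubfield L))} (huF : uF ≠ 0) (hβ : β ≠ 0)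
    (hu : hilbertSymbol (v.adicCompletion ↥(maximalRealSubfield L)) uF (algebraMap ↥(maximalRealSubfield L) (v.adicCompletion ↥(maximalRealSubfield L)) ((cmQuadraticGenerator L : 𝓞 ↥(maximalRealSubfield L)) : ↥(maximalRealSubfield L))) = -1) :
    (hilbertSymbol (v.adicCompletion ↥(maximalRealSubfield L)) β (algebraMap ↥(maximalRealSubfield L) (v.adicCompletion ↥(maximalRealSubfield L)) ((cmQuadraticGenerator L : 𝓞 ↥(maximalRealSubfield L)) : ↥(maximalRealSubfield L))) = 1 ∧ ∃ z : (w.1.adicCompletion L), z * (galAdicCompletionMap (L := L) (IsCMField.complexConj L) hw) z = toPlace v w β) ∨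
      (hilbertSymbol (v.adicCompletion ↥(maximalRealSubfield L)) β (algebraMap ↥(maximalRealSubfield L) (v.adicCompletion ↥(maximalRealSubfield L)) ((cmQuadraticGenerator L : 𝓞 ↥(maximalRealSubfield L)) : ↥(maximalRealSubfield L))) = -1 ∧ (∃ z : (w.1.adicCompletion L), z * (galAdicCompletionMap (L := L) (IsCMField.complexConj L) hw) z = toPlace v w (β / uF)) ∧
        ∃ z : (w.1.adicCompletion L), z * (galAdicCompletionMap (L := L) (IsCMField.complexConj L) hw) z = toPlace v w (β * uF)) := by
  have hθ0 := theta_ne_zero L v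
  rcases hilbertSymbol_eq_one_or_eq_neg_one β (algebraMap ↥(maximalRealSubfield L) (v.adicCompletion ↥(maximalRealSubfield L)) ((cmQuadraticGenerator L : 𝓞 ↥(maximalRealSubfield L)) : ↥(maximalRealSubfield L))) with h | h
  · exact Or.inl ⟨h, exists_mul_galAdicCompletionMap_eq_toPlace_of_hilbertSymbol_eq_one L v w hw hβ h⟩
  · refine Or.inr ⟨h, ?_, ?_⟩
    · refine exists_mul_galAdicCompletionMap_eq_toPlace_of_hilbertSymbol_eq_one L v w hw (div_ne_zero hβ huF) ?_
      have hrew : β / uF = β * uF * uF⁻¹ ^ 2 := by field_simp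
      rw [hrew, hilbertSymbol_mul_sq_left _ _ (inv_ne_zero huF), hilbertSymbol_adicCompletion_mul_left (hx := hβ) (hy := huF) (ha := hθ0), h, hu]
      norm_num
    · refine exists_mul_galAdicCompletionMap_eq_toPlace_of_hilbertSymbol_eq_one L v w hw (mul_ne_zero hβ huF) ?_
      rw [hilbertSymbol_adicCompletion_mul_left (hx := hβ) (hy := huF) (ha := hθ0), h, hu]
      norm_num

/-! ## §2 Diagonal bookkeeping: `D_y = diag(1, y)` as an element of `GL₂` -/

omit [IsCMField L] in
/-- The matrix of `D_y := glDiagonal ![1, y]`. [folklore] -/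
private theorem coe_glDiagonal_one_mk0 {y : (v.adicCompletion ↥(maximalRealSubfield L))} (hy : y ≠ 0) :
    (((glDiagonal 2 (v.adicCompletion ↥(maximalRealSubfield L)) ![1, Units.mk0 (y) (hy)]) : GL (Fin 2) (v.adicCompletion ↥(maximalRealSubfield L))) : Matrix (Fin 2) (Fin 2) (v.adicCompletion ↥(maximalRealSubfield L))) = Matrix.diagonal ![1, y] := by
  rw [coe_glDiagonal]
  congr 1
  funext k
  fin_cases k <;> rfl

omit [IsCMField L] in
/-- `D_y ∈ GL₂(𝒪_v)` for a unit `y`. [cite: Serre1980Trees, Ch. II §1.3] -/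
theorem glDiagonal_one_mk0_mem_glInt {y : (v.adicCompletion ↥(maximalRealSubfield L))} (hy : y ≠ 0) (hy1 : valuation (v.adicCompletion ↥(maximalRealSubfield L)) y = 1) :
    (glDiagonal 2 (v.adicCompletion ↥(maximalRealSubfield L)) ![1, Units.mk0 (y) (hy)]) ∈ glInt 2 (v.adicCompletion ↥(maximalRealSubfield L)) := by
  refine mem_glInt_of_isIntegralMatrix (fun i j => ?_) ?_
  · rw [coe_glDiagonal_one_mk0 L v hy]
    fin_cases i <;> fin_cases j
    · simp
    · simp
    · simp
    · simpa [Valuation.mem_integer_iff] using hy1.le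
  · rw [coe_glDiagonal_one_mk0 L v hy, Matrix.det_diagonal]
    simpa [Fin.prod_univ_two] using hy1

omit [IsCMField L] in
/-- `det D_y = y`. [folklore] -/
private theorem det_glDiagonal_one_mk0 {y : (v.adicCompletion ↥(maximalRealSubfield L))} (hy : y ≠ 0) :
    ((((glDiagonal 2 (v.adicCompletion ↥(maximalRealSubfield L)) ![1, Units.mk0 (y) (hy)]) : GL (Fin 2) (v.adicCompletion ↥(maximalRealSubfield L))) : Matrix (Fin 2) (Fin 2) (v.adicCompletion ↥(maximalRealSubfield L)))).det = y := by
  rw [coe_glDiagonal_one_mk0 L v hy, Matrix.det_diagonal]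
  simp [Fin.prod_univ_two]

omit [IsCMField L] in
/-- Bookkeeping (private): `D_u⁻¹ · D_x = D_{x∕u}`. [folklore] -/
private theorem glDiagonal_inv_mul_eq_div {u x : (v.adicCompletion ↥(maximalRealSubfield L))} (hu : u ≠ 0) (hx : x ≠ 0) :
    ((glDiagonal 2 (v.adicCompletion ↥(maximalRealSubfield L)) ![1, Units.mk0 (u) (hu)]))⁻¹ * (glDiagonal 2 (v.adicCompletion ↥(maximalRealSubfield L)) ![1, Units.mk0 (x) (hx)]) = (glDiagonal 2 (v.adicCompletion ↥(maximalRealSubfield L)) ![1, Units.mk0 (x / u) (div_ne_zero hx hu)]) := by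
  rw [← map_inv, ← map_mul]
  congr 1
  funext k
  fin_cases k
  · simp
  · ext
    simp [div_eq_mul_inv, mul_comm]

omit [IsCMField L] in
/-- Bookkeeping (private): `D_u⁻¹ · D_{x u} = D_x`. [folklore] -/
private theorem glDiagonal_inv_mul_eq_of_mul {u x : (v.adicCompletion ↥(maximalRealSubfield L))} (hu : u ≠ 0) (hx : x ≠ 0) :
    ((glDiagonal 2 (v.adicCompletion ↥(maximalRealSubfield L)) ![1, Units.mk0 (u) (hu)]))⁻¹ * (glDiagonal 2 (v.adicCompletion ↥(maximalRealSubfield L)) ![1, Units.mk0 (x * u) (mul_ne_zero hx hu)]) = (glDiagonal 2 (v.adicCompletion ↥(maximalRealSubfield L)) ![1, Units.mk0 (x) (hx)]) := by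
  rw [← map_inv, ← map_mul]
  congr 1
  funext k
  fin_cases k
  · simp
  · ext
    simp [mul_comm]

omit [IsCMField L] in
/-- **Renormalising the partner by `D_x` lands on the `D_{x∕u}`-normal form**: `D_x⁻¹ (D_u S D_u⁻¹) D_x = D_{x∕u}⁻¹ S D_{x∕u}`. [cite: LabesseLanglands1979, §2 (2.2) p. 9] -/
theorem glDiagonal_inv_mul_conj_mul_eq_div {u x : (v.adicCompletion ↥(maximalRealSubfield L))} (hu : u ≠ 0) (hx : x ≠ 0) (S : GL (Fin 2) (v.adicCompletion ↥(maximalRealSubfield L))) :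
    ((glDiagonal 2 (v.adicCompletion ↥(maximalRealSubfield L)) ![1, Units.mk0 (x) (hx)]))⁻¹ * ((glDiagonal 2 (v.adicCompletion ↥(maximalRealSubfield L)) ![1, Units.mk0 (u) (hu)]) * S * ((glDiagonal 2 (v.adicCompletion ↥(maximalRealSubfield L)) ![1, Units.mk0 (u) (hu)]))⁻¹) * (glDiagonal 2 (v.adicCompletion ↥(maximalRealSubfield L)) ![1, Units.mk0 (x) (hx)]) =
      ((glDiagonal 2 (v.adicCompletion ↥(maximalRealSubfield L)) ![1, Units.mk0 (x / u) (div_ne_zero hx hu)]))⁻¹ * S * (glDiagonal 2 (v.adicCompletion ↥(maximalRealSubfield L)) ![1, Units.mk0 (x / u) (div_ne_zero hx hu)]) := by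
  rw [← glDiagonal_inv_mul_eq_div L v hu hx]
  group

omit [IsCMField L] in
/-- **Renormalising the partner by `D_{x u}` lands on the `D_x`-normal form**: `D_{xu}⁻¹ (D_u S D_u⁻¹) D_{xu} = D_x⁻¹ S D_x`. [cite: LabesseLanglands1979, §2 (2.2) p. 9] -/
theorem glDiagonal_inv_mul_conj_mul_eq_of_mul {u x : (v.adicCompletion ↥(maximalRealSubfield L))} (hu : u ≠ 0) (hx : x ≠ 0) (S : GL (Fin 2) (v.adicCompletion ↥(maximalRealSubfield L))) :
    ((glDiagonal 2 (v.adicCompletion ↥(maximalRealSubfield L)) ![1, Units.mk0 (x * u) (mul_ne_zero hx hu)]))⁻¹ * ((glDiagonal 2 (v.adicCompletion ↥(maximalRealSubfield L)) ![1, Units.mk0 (u) (hu)]) * S * ((glDiagonal 2 (v.adicCompletion ↥(maximalRealSubfield L)) ![1, Units.mk0 (u) (hu)]))⁻¹) * (glDiagonal 2 (v.adicCompletion ↥(maximalRealSubfield L)) ![1, Units.mk0 (x * u) (mul_ne_zero hx hu)]) =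
      ((glDiagonal 2 (v.adicCompletion ↥(maximalRealSubfield L)) ![1, Units.mk0 (x) (hx)]))⁻¹ * S * (glDiagonal 2 (v.adicCompletion ↥(maximalRealSubfield L)) ![1, Units.mk0 (x) (hx)]) := by
  rw [← glDiagonal_inv_mul_eq_of_mul L v hu hx]
  group

/-! ## §3 The window sign at one shell -/

variable {α : (w.1.adicCompletion L)} (hα : (galAdicCompletionMap (L := L) (IsCMField.complexConj L) hw) α = -α) (hα0 : α ≠ 0)
  {ϖF : (v.adicCompletion ↥(maximalRealSubfield L))} (hϖF : Valued.v ϖF = WithZero.exp (-1 : ℤ))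
  (E₂ : (cmDatum L 2 (Matrix.of fun i j : Fin 2 => if i.val + j.val + 1 = 2 then (1 : L) else 0)).Local v ≃ₜ* ↥(unitaryGroupOfForm (galAdicCompletionMap (L := L) (IsCMField.complexConj L) hw) (placeForm (Matrix.of fun i j : Fin 2 => if i.val + j.val + 1 = 2 then (1 : L) else 0) w.1))) (K : Subgroup ((cmDatum L 2 (Matrix.of fun i j : Fin 2 => if i.val + j.val + 1 = 2 then (1 : L) else 0)).Local v)) (x₀ : {M : Submodule 𝒪[v.adicCompletion ↥(maximalRealSubfield L)] (Fin 2 → v.adicCompletion ↥(maximalRealSubfield L)) // IsSpecialLattice (RingHom.id _) ϖF !![(0 : v.adicCompletion ↥(maximalRealSubfield L)), 1; -1, 0] M})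
  (hK : ∀ g, g ∈ K ↔ rhoVertexActPlace L v w hw hα hα0 hϖF (E₂ g) x₀ = x₀)
  [MeasurableSpace ((cmDatum L 2 (Matrix.of fun i j : Fin 2 => if i.val + j.val + 1 = 2 then (1 : L) else 0)).Local v × (cmDatum L 1 (Matrix.of fun i j : Fin 1 => if i.val + j.val + 1 = 1 then (1 : L) else 0)).Local v)] [BorelSpace ((cmDatum L 2 (Matrix.of fun i j : Fin 2 => if i.val + j.val + 1 = 2 then (1 : L) else 0)).Local v × (cmDatum L 1 (Matrix.of fun i j : Fin 1 => if i.val + j.val + 1 = 1 then (1 : L) else 0)).Local v)] (ν : Measure ((cmDatum L 2 (Matrix.of fun i j : Fin 2 => if i.val + j.val + 1 = 2 then (1 : L) else 0)).Local v × (cmDatum L 1 (Matrix.of fun i j : Fin 1 => if i.val + j.val + 1 = 1 then (1 : L) else 0)).Local v)) [ν.IsMulLeftInvariant]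

include hK in
/-- **THE WINDOW SIGN AT ONE SHELL.**  `X ∈ U_w` (the shell conjugate of `t`) has descent `ζ · ι(S)`, `Y ∈ U_w` (the shell conjugate of the partner `e t`) has descent
`ζ · ι(D_{u_F} S D_{u_F}⁻¹)`, `u_F` is a unit with `(u_F, θ)_v = −1` and `β₁` is a unit (`≠ 0`, valuation `1` — the unit part of the torus coordinate at the window).  Then there are
`X_A, X_B ∈ U_w` with descents `ζ · ι(D_{β₁}⁻¹ S D_{β₁})` and `ζ · ι(D_{β₁∕u_F}⁻¹ S D_{β₁∕u_F})` (the `β₁`-free NORMAL FORMS) such that for every `f` and every `a ∈ U(Φ₁)_v`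
`F̄(X, a) − F̄(Y, a) = (β₁, θ)_v · (F̄(X_A, a) − F̄(X_B, a))`, `F̄(Z, a) := ∫_{K × U(Φ₁)_v} f(k⁻¹ (E₂⁻¹ Z, a) k) dν(k)` — i.e. the `κT t · (Φ i t − ΦD i t)` shape of (W′-B6)'s `hwin`.
[cite: LabesseLanglands1979, §2 (2.2) p. 9] [cite: Labesse2024StabilisationGermesSL2, Th. 0.0.12] [cite: Omeara1963, §63B] -/
theorem exists_normalForms_setIntegral_sub_eq_hilbertSymbol_mul [IsDiscreteValuationRing 𝒪[(v.adicCompletion ↥(maximalRealSubfield L))]]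
    (hKo : IsOpen (((K.prod (⊤ : Subgroup ((cmDatum L 1 (Matrix.of fun i j : Fin 1 => if i.val + j.val + 1 = 1 then (1 : L) else 0)).Local v))) : Subgroup ((cmDatum L 2 (Matrix.of fun i j : Fin 2 => if i.val + j.val + 1 = 2 then (1 : L) else 0)).Local v × (cmDatum L 1 (Matrix.of fun i j : Fin 1 => if i.val + j.val + 1 = 1 then (1 : L) else 0)).Local v)) : Set ((cmDatum L 2 (Matrix.of fun i j : Fin 2 => if i.val + j.val + 1 = 2 then (1 : L) else 0)).Local v × (cmDatum L 1 (Matrix.of fun i j : Fin 1 => if i.val + j.val + 1 = 1 then (1 : L) else 0)).Local v))) (hx₀ : x₀.1 = latt (1 : Matrix (Fin 2) (Fin 2) (v.adicCompletion ↥(maximalRealSubfield L))))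
    {uF β₁ : (v.adicCompletion ↥(maximalRealSubfield L))} (huF0 : uF ≠ 0) (huF1 : valuation (v.adicCompletion ↥(maximalRealSubfield L)) uF = 1) (hu : hilbertSymbol (v.adicCompletion ↥(maximalRealSubfield L)) uF (algebraMap ↥(maximalRealSubfield L) (v.adicCompletion ↥(maximalRealSubfield L)) ((cmQuadraticGenerator L : 𝓞 ↥(maximalRealSubfield L)) : ↥(maximalRealSubfield L))) = -1)
    (hβ0 : β₁ ≠ 0) (hβ1 : valuation (v.adicCompletion ↥(maximalRealSubfield L)) β₁ = 1)
    (X Y : ↥(unitaryGroupOfForm (galAdicCompletionMap (L := L) (IsCMField.complexConj L) hw) (placeForm (Matrix.of fun i j : Fin 2 => if i.val + j.val + 1 = 2 then (1 : L) else 0) w.1))) {ζ : (w.1.adicCompletion L)} {S : GL (Fin 2) (v.adicCompletion ↥(maximalRealSubfield L))}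
    (hX : Matrix.diagonal ![1, α] * ((X : GL (Fin 2) (w.1.adicCompletion L)) : Matrix (Fin 2) (Fin 2) (w.1.adicCompletion L)) * Matrix.diagonal ![1, α⁻¹] = ζ • ((S : GL (Fin 2) (v.adicCompletion ↥(maximalRealSubfield L))) : Matrix (Fin 2) (Fin 2) (v.adicCompletion ↥(maximalRealSubfield L))).map (toPlace v w))
    (hY : Matrix.diagonal ![1, α] * ((Y : GL (Fin 2) (w.1.adicCompletion L)) : Matrix (Fin 2) (Fin 2) (w.1.adicCompletion L)) * Matrix.diagonal ![1, α⁻¹] = ζ • (((glDiagonal 2 (v.adicCompletion ↥(maximalRealSubfield L)) ![1, Units.mk0 (uF) (huF0)]) * S * ((glDiagonal 2 (v.adicCompletion ↥(maximalRealSubfield L)) ![1, Units.mk0 (uF) (huF0)]))⁻¹ : GL (Fin 2) (v.adicCompletion ↥(maximalRealSubfield L))) : Matrix (Fin 2) (Fin 2) (v.adicCompletion ↥(maximalRealSubfield L))).map (toPlace v w)) :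
    ∃ XA XB : ↥(unitaryGroupOfForm (galAdicCompletionMap (L := L) (IsCMField.complexConj L) hw) (placeForm (Matrix.of fun i j : Fin 2 => if i.val + j.val + 1 = 2 then (1 : L) else 0) w.1)),
      Matrix.diagonal ![1, α] * ((XA : GL (Fin 2) (w.1.adicCompletion L)) : Matrix (Fin 2) (Fin 2) (w.1.adicCompletion L)) * Matrix.diagonal ![1, α⁻¹] = ζ • ((((glDiagonal 2 (v.adicCompletion ↥(maximalRealSubfield L)) ![1, Units.mk0 (β₁) (hβ0)]))⁻¹ * S * (glDiagonal 2 (v.adicCompletion ↥(maximalRealSubfield L)) ![1, Units.mk0 (β₁) (hβ0)]) : GL (Fin 2) (v.adicCompletion ↥(maximalRealSubfield L))) : Matrix (Fin 2) (Fin 2) (v.adicCompletion ↥(maximalRealSubfield L))).map (toPlace v w) ∧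
      Matrix.diagonal ![1, α] * ((XB : GL (Fin 2) (w.1.adicCompletion L)) : Matrix (Fin 2) (Fin 2) (w.1.adicCompletion L)) * Matrix.diagonal ![1, α⁻¹] = ζ • ((((glDiagonal 2 (v.adicCompletion ↥(maximalRealSubfield L)) ![1, Units.mk0 (β₁ / uF) (div_ne_zero hβ0 huF0)]))⁻¹ * S * (glDiagonal 2 (v.adicCompletion ↥(maximalRealSubfield L)) ![1, Units.mk0 (β₁ / uF) (div_ne_zero hβ0 huF0)]) : GL (Fin 2) (v.adicCompletion ↥(maximalRealSubfield L))) : Matrix (Fin 2) (Fin 2) (v.adicCompletion ↥(maximalRealSubfield L))).map (toPlace v w) ∧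
      ∀ (f : ((cmDatum L 2 (Matrix.of fun i j : Fin 2 => if i.val + j.val + 1 = 2 then (1 : L) else 0)).Local v × (cmDatum L 1 (Matrix.of fun i j : Fin 1 => if i.val + j.val + 1 = 1 then (1 : L) else 0)).Local v) → ℂ) (a : (cmDatum L 1 (Matrix.of fun i j : Fin 1 => if i.val + j.val + 1 = 1 then (1 : L) else 0)).Local v),
        (∫ k in (((K.prod (⊤ : Subgroup ((cmDatum L 1 (Matrix.of fun i j : Fin 1 => if i.val + j.val + 1 = 1 then (1 : L) else 0)).Local v))) : Subgroup ((cmDatum L 2 (Matrix.of fun i j : Fin 2 => if i.val + j.val + 1 = 2 then (1 : L) else 0)).Local v × (cmDatum L 1 (Matrix.of fun i j : Fin 1 => if i.val + j.val + 1 = 1 then (1 : L) else 0)).Local v)) : Set ((cmDatum L 2 (Matrix.of fun i j : Fin 2 => if i.val + j.val + 1 = 2 then (1 : L) else 0)).Local v × (cmDatum L 1 (Matrix.of fun i j : Fin 1 => if i.val + j.val + 1 = 1 then (1 : L) else 0)).Local v)), f (k⁻¹ * ((E₂.symm X, a) : ((cmDatum L 2 (Matrix.of fun i j : Fin 2 =>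 if i.val + j.val + 1 = 2 then (1 : L) else 0)).Local v × (cmDatum L 1 (Matrix.of fun i j : Fin 1 => if i.val + j.val + 1 = 1 then (1 : L) else 0)).Local v)) * k) ∂ν) - ∫ k in (((K.prod (⊤ : Subgroup ((cmDatum L 1 (Matrix.of fun i j : Fin 1 => if i.val + j.val + 1 = 1 then (1 : L) else 0)).Local v))) : Subgroup ((cmDatum L 2 (Matrix.of fun i j : Fin 2 => if i.val + j.val + 1 = 2 then (1 : L) else 0)).Local v × (cmDatum L 1 (Matrix.of fun i j : Fin 1 => if i.val + j.val + 1 = 1 then (1 : L) else 0)).Local v)) : Set ((cmDatum L 2 (Matrix.of fun i j : Fin 2 => if i.val + j.val + 1 = 2 then (1 : L) else 0)).Local v × (cmDatum L 1 (Matrix.of fun i j : Fin 1 => if i.val + j.val + 1 = 1 then (1 : L) else 0)).Local v)), f (k⁻¹ * ((E₂.symm Y, a) : ((cmDatum L 2 (Matrix.of fun i j : Fin 2 => if i.val + j.val + 1 = 2 then (1 : L) else 0)).Local v × (cmDatum L 1 (Matrix.of fun i j : Fin 1 => if i.val + j.val + 1 = 1 then (1 : L) else 0)).Local v)) * k) ∂ν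 =
          ((hilbertSymbol (v.adicCompletion ↥(maximalRealSubfield L)) β₁ (algebraMap ↥(maximalRealSubfield L) (v.adicCompletion ↥(maximalRealSubfield L)) ((cmQuadraticGenerator L : 𝓞 ↥(maximalRealSubfield L)) : ↥(maximalRealSubfield L))) : ℤ) : ℂ) * ((∫ k in (((K.prod (⊤ : Subgroup ((cmDatum L 1 (Matrix.of fun i j : Fin 1 => if i.val + j.val + 1 = 1 then (1 : L) else 0)).Local v))) : Subgroup ((cmDatum L 2 (Matrix.of fun i j : Fin 2 => if i.val + j.val + 1 = 2 then (1 : L) else 0)).Local v × (cmDatum L 1 (Matrix.of fun i j : Fin 1 => if i.val + j.val + 1 = 1 then (1 : L) else 0)).Local v)) : Set ((cmDatum L 2 (Matrix.of fun i j : Fin 2 => if i.val + j.val + 1 = 2 then (1 : L) else 0)).Local v × (cmDatum L 1 (Matrix.of fun i j : Fin 1 => if i.val + j.val + 1 = 1 then (1 : L) else 0)).Local v)), f (k⁻¹ * ((E₂.symm XA, a) : ((cmDatum L 2 (Matrix.of fun i j : Fin 2 => if i.val + j.val + 1 = 2 then (1 : L) else 0)).Local v × (cmDatum L 1 (Matrix.of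 fun i j : Fin 1 => if i.val + j.val + 1 = 1 then (1 : L) else 0)).Local v)) * k) ∂ν) - ∫ k in (((K.prod (⊤ : Subgroup ((cmDatum L 1 (Matrix.of fun i j : Fin 1 => if i.val + j.val + 1 = 1 then (1 : L) else 0)).Local v))) : Subgroup ((cmDatum L 2 (Matrix.of fun i j : Fin 2 => if i.val + j.val + 1 = 2 then (1 : L) else 0)).Local v × (cmDatum L 1 (Matrix.of fun i j : Fin 1 => if i.val + j.val + 1 = 1 then (1 : L) else 0)).Local v)) : Set ((cmDatum L 2 (Matrix.of fun i j : Fin 2 => if i.val + j.val + 1 = 2 then (1 : L) else 0)).Local v × (cmDatum L 1 (Matrix.of fun i j : Fin 1 => if i.val + j.val + 1 = 1 then (1 : L) else 0)).Local v)), f (k⁻¹ * ((E₂.symm XB, a) : ((cmDatum L 2 (Matrix.of fun i j : Fin 2 => if i.val + j.val + 1 = 2 then (1 : L) else 0)).Local v × (cmDatum L 1 (Matrix.of fun i j : Fin 1 => if i.val + j.val + 1 = 1 then (1 : L) else 0)).Local v)) * k) ∂ν) := by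
  -- determinants and integrality of the renormalising diagonals
  have hval : ∀ {y : (v.adicCompletion ↥(maximalRealSubfield L))} (hy : y ≠ 0), valuation (v.adicCompletion ↥(maximalRealSubfield L)) y = 1 → ∀ {z : (w.1.adicCompletion L)}, z * (galAdicCompletionMap (L := L) (IsCMField.complexConj L) hw) z = toPlace v w y →
      (galAdicCompletionMap (L := L) (IsCMField.complexConj L) hw) z⁻¹ * z⁻¹ * toPlace v w ((((glDiagonal 2 (v.adicCompletion ↥(maximalRealSubfield L)) ![1, Units.mk0 (y) (hy)]) : GL (Fin 2) (v.adicCompletion ↥(maximalRealSubfield L))) : Matrix (Fin 2) (Fin 2) (v.adicCompletion ↥(maximalRealSubfield L)))).det = 1 := by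
    intro y hy hy1 z hz
    rw [det_glDiagonal_one_mk0 L v hy, ← hz]
    have hz0 : z ≠ 0 := by
      rintro rfl
      rw [zero_mul, eq_comm, map_eq_zero] at hz
      exact hy hz
    have hσz0 : (galAdicCompletionMap (L := L) (IsCMField.complexConj L) hw) z ≠ 0 := (map_ne_zero _).2 hz0
    rw [map_inv₀]
    field_simp
  rcases norm_dichotomy_of_hilbertSymbol_eq_neg_one L v w hw huF0 hβ0 hu with ⟨hκ, z, hz⟩ | ⟨hκ, ⟨z, hz⟩, z', hz'⟩
  · -- `β₁` is a norm: `X ↦ A` by `D_{β₁}`, `Y ↦ B` by the same `D_{β₁}`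
    obtain ⟨XA, hXA, hFA⟩ := exists_descent_conj_and_setIntegral_conj_prod_eq (E := ℂ) L v w hw hα hα0 hϖF E₂ K x₀ hK ν hKo hx₀
      (glDiagonal_one_mk0_mem_glInt L v hβ0 hβ1) (hval hβ0 hβ1 hz) X hX
    obtain ⟨XB, hXB, hFB⟩ := exists_descent_conj_and_setIntegral_conj_prod_eq (E := ℂ) L v w hw hα hα0 hϖF E₂ K x₀ hK ν hKo hx₀
      (glDiagonal_one_mk0_mem_glInt L v hβ0 hβ1) (hval hβ0 hβ1 hz) Y hY
    rw [glDiagonal_inv_mul_conj_mul_eq_div L v huF0 hβ0] at hXB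
    refine ⟨XA, XB, hXA, hXB, fun f a => ?_⟩
    rw [hκ, ← hFA f a, ← hFB f a]
    push_cast
    ring
  · -- `β₁` is not a norm: `X ↦ B` by `D_{β₁∕u_F}`, `Y ↦ A` by `D_{β₁ u_F}`
    have hβu1 : valuation (v.adicCompletion ↥(maximalRealSubfield L)) (β₁ / uF) = 1 := by rw [map_div₀, hβ1, huF1, div_one]
    have hβu1' : valuation (v.adicCompletion ↥(maximalRealSubfield L)) (β₁ * uF) = 1 := by rw [map_mul, hβ1, huF1, one_mul]
    obtain ⟨XB, hXB, hFB⟩ := exists_descent_conj_and_setIntegral_conj_prod_eq (E := ℂ) L v w hw hα hα0 hϖF E₂ K x₀ hK ν hKo hx₀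
      (glDiagonal_one_mk0_mem_glInt L v (div_ne_zero hβ0 huF0) hβu1) (hval (div_ne_zero hβ0 huF0) hβu1 hz) X hX
    obtain ⟨XA, hXA, hFA⟩ := exists_descent_conj_and_setIntegral_conj_prod_eq (E := ℂ) L v w hw hα hα0 hϖF E₂ K x₀ hK ν hKo hx₀
      (glDiagonal_one_mk0_mem_glInt L v (mul_ne_zero hβ0 huF0) hβu1') (hval (mul_ne_zero hβ0 huF0) hβu1' hz') Y hY
    rw [glDiagonal_inv_mul_conj_mul_eq_of_mul L v huF0 hβ0] at hXA
    refine ⟨XA, XB, hXA, hXB, fun f a => ?_⟩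
    rw [hκ, ← hFA f a, ← hFB f a]
    push_cast
    ring

end Literature.NumberTheory.Rogawski1990

end
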